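import Mathlib.Analysis.Calculus.LineDeriv.IntegrationByParts
import Mathlib.Analysis.SpecialFunctions.Gaussian.GaussianIntegral
import Mathlib.Probability.Distributions.Gaussian.Real
import Mathlib.MeasureTheory.Integral.Pi
import Literature.Probability.Distributions.GaussianPiDensity

/-!
# Gaussian integration by parts on a finite product and skew linear drifts

Generic helper file for the harmonic tightness witness of `ParityLiouvilleSeed.LiouvilleForHeat`
(`stmt-AtomisticToContinuum-13980`): the time invariance of the radiating Gaussian state is proved by
lifting the harmonic flow to a linear drift on the driving white noise which is skew for the noise
covariance; this file supplies the finite-dimensional Gaussian calculus for that argument.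

On `E = ι → ℝ` (`ι` a `Fintype`) let `μ_v = ⊗ᵢ N(0, vᵢ)` (`Measure.pi`, all `vᵢ ≠ 0`).

* `pi_gaussianReal_eq_withDensity_prod` — `μ_v = (∏ᵢ φ_{vᵢ}(zᵢ)) dz`;
* `hasFDerivAt_prod_gaussianPDFReal` — `∂_k ∏ᵢ φ_{vᵢ}(zᵢ) = -(z_k / v_k) ∏ᵢ φ_{vᵢ}(zᵢ)`;
* `gaussian_integral_byParts` — **Stein / Gaussian integration by parts**:
  `v_k ∫ ∂_k H dμ_v = ∫ z_k H dμ_v` for `H` differentiable with the three integrands integrable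
  (Mathlib's `integral_bilinear_hasFDerivAt_right_eq_neg_left_of_integrable` against the density);
* `integral_fderiv_apply_skewDrift_eq_zero` — for a linear drift `D` with
  `v_l D(e_l)_k = -v_k D(e_k)_l` (skew for the covariance `diag v`) and `H ∈ C¹_b`,
  `∫ DH(z)[D z] dμ_v(z) = 0`: the Gaussian measure is infinitesimally invariant under the flow of `D`.
-/

noncomputable section

open MeasureTheory ProbabilityTheory
open scoped NNReal ENNReal

namespace Summit.AtomisticToContinuum.FouriersLaw.Theorems.ParityLiouvilleSeed.HarmonicWitness

variable {ι : Type*} [Fintype ι] [DecidableEq ι]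

/-! ### Product densities over a `Fintype` -/

omit [DecidableEq ι] in
/-- Tonelli for finite products over a `Fintype` (transport of the `Fin n` case of
`Literature.Probability.Distributions.lintegral_fin_nat_prod_eq_prod`). [folklore] -/
theorem lintegral_prod_eq_prod_lintegral {X : ι → Type*} [∀ i, MeasurableSpace (X i)]
    (μ : ∀ i, Measure (X i)) [∀ i, SigmaFinite (μ i)] {f : ∀ i, X i → ℝ≥0∞} (hf : ∀ i, Measurable (f i)) :
    ∫⁻ x, ∏ i, f i (x i) ∂Measure.pi μ = ∏ i, ∫⁻ x, f i x ∂μ i := by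
  let e := (Fintype.equivFin ι).symm
  rw [← (measurePreserving_piCongrLeft _ e).lintegral_comp_emb (MeasurableEquiv.measurableEmbedding _)]
  simp_rw [← e.prod_comp, MeasurableEquiv.coe_piCongrLeft, Equiv.piCongrLeft_apply_apply,
    Literature.Probability.Distributions.lintegral_fin_nat_prod_eq_prod _ _ (fun i => hf _)]

omit [DecidableEq ι] in
/-- `⊗ᵢ (dᵢ · μᵢ) = (∏ᵢ dᵢ(xᵢ)) · ⊗ᵢ μᵢ` for real non-negative densities over a `Fintype`. [folklore] -/
theorem pi_withDensity_ofReal {X : Type*} [MeasurableSpace X] (μ : ι → Measure X) [∀ i, SigmaFinite (μ i)]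
    (d : ι → X → ℝ) (hd : ∀ i, Measurable (d i)) (hd0 : ∀ i x, 0 ≤ d i x) :
    Measure.pi (fun i => (μ i).withDensity fun x => ENNReal.ofReal (d i x)) =
      (Measure.pi μ).withDensity fun x => ENNReal.ofReal (∏ i, d i (x i)) := by
  refine Measure.pi_eq fun s hs => ?_
  rw [withDensity_apply _ (MeasurableSet.univ_pi hs), Measure.restrict_pi_pi]
  have e : (fun x : ι → X => ENNReal.ofReal (∏ i, d i (x i))) = fun x => ∏ i, ENNReal.ofReal (d i (x i)) :=
    funext fun x => ENNReal.ofReal_prod_of_nonneg fun i _ => hd0 i (x i)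
  rw [e, lintegral_prod_eq_prod_lintegral (f := fun i x => ENNReal.ofReal (d i x)) _
    (fun i => ENNReal.measurable_ofReal.comp (hd i))]
  exact Finset.prod_congr rfl fun i _ => (withDensity_apply _ (hs i)).symm

omit [DecidableEq ι] in
/-- **The product Gaussian as a density**: `⊗ᵢ N(0, vᵢ) = (∏ᵢ φ_{vᵢ}(zᵢ)) dz` (all `vᵢ ≠ 0`).
[folklore] -/
theorem pi_gaussianReal_eq_withDensity_prod (v : ι → ℝ≥0) (hv : ∀ i, v i ≠ 0) :
    Measure.pi (fun i => gaussianReal 0 (v i)) =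
      (volume : Measure (ι → ℝ)).withDensity fun z => ENNReal.ofReal (∏ i, gaussianPDFReal 0 (v i) (z i)) := by
  have h : (fun i => gaussianReal 0 (v i)) =
      fun i => (volume : Measure ℝ).withDensity fun x => ENNReal.ofReal (gaussianPDFReal 0 (v i) x) := by
    funext i
    rw [gaussianReal_of_var_ne_zero 0 (hv i)]
    rfl
  rw [h, pi_withDensity_ofReal (fun _ => (volume : Measure ℝ)) _ (fun i => measurable_gaussianPDFReal 0 (v i))
    (fun i x => gaussianPDFReal_nonneg 0 (v i) x), volume_pi]

omit [DecidableEq ι] in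
/-- The product Gaussian density is non-negative. [folklore] -/
theorem prod_gaussianPDFReal_nonneg (v : ι → ℝ≥0) (z : ι → ℝ) : 0 ≤ ∏ i, gaussianPDFReal 0 (v i) (z i) :=
  Finset.prod_nonneg fun i _ => gaussianPDFReal_nonneg 0 (v i) (z i)

omit [DecidableEq ι] in
/-- The product Gaussian density is continuous. [folklore] -/
theorem continuous_prod_gaussianPDFReal (v : ι → ℝ≥0) :
    Continuous fun z : ι → ℝ => ∏ i, gaussianPDFReal 0 (v i) (z i) := by
  refine continuous_finsetProd _ fun i _ => ?_
  have hc : Continuous (gaussianPDFReal 0 (v i)) := by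
    rw [gaussianPDFReal_def]; fun_prop
  exact hc.comp (continuous_apply i)

omit [DecidableEq ι] in
/-- The `ℝ≥0∞`-valued product Gaussian density is measurable. [folklore] -/
theorem measurable_ofReal_prod_gaussianPDFReal (v : ι → ℝ≥0) :
    Measurable fun z : ι → ℝ => ENNReal.ofReal (∏ i, gaussianPDFReal 0 (v i) (z i)) :=
  ENNReal.measurable_ofReal.comp (continuous_prod_gaussianPDFReal v).measurable

omit [DecidableEq ι] in
/-- Integration against `μ_v` is integration against the density. [folklore] -/
theorem integral_pi_gaussianReal_eq (v : ι → ℝ≥0) (hv : ∀ i, v i ≠ 0) (g : (ι → ℝ) → ℝ) :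
    ∫ z, g z ∂Measure.pi (fun i => gaussianReal 0 (v i)) =
      ∫ z, (∏ i, gaussianPDFReal 0 (v i) (z i)) * g z := by
  rw [pi_gaussianReal_eq_withDensity_prod v hv,
    integral_withDensity_eq_integral_toReal_smul (measurable_ofReal_prod_gaussianPDFReal v)
      (Filter.Eventually.of_forall fun _ => ENNReal.ofReal_lt_top)]
  refine integral_congr_ae (ae_of_all _ fun z => ?_)
  dsimp only
  rw [ENNReal.toReal_ofReal (prod_gaussianPDFReal_nonneg v z), smul_eq_mul]

omit [DecidableEq ι] in
/-- Integrability against `μ_v` is integrability against the density. [folklore] -/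
theorem integrable_pi_gaussianReal_iff (v : ι → ℝ≥0) (hv : ∀ i, v i ≠ 0) (g : (ι → ℝ) → ℝ) :
    Integrable g (Measure.pi (fun i => gaussianReal 0 (v i))) ↔
      Integrable (fun z => (∏ i, gaussianPDFReal 0 (v i) (z i)) * g z) := by
  rw [pi_gaussianReal_eq_withDensity_prod v hv,
    integrable_withDensity_iff_integrable_smul' (measurable_ofReal_prod_gaussianPDFReal v)
      (Filter.Eventually.of_forall fun _ => ENNReal.ofReal_lt_top)]
  refine integrable_congr (ae_of_all _ fun z => ?_)
  dsimp only
  rw [ENNReal.toReal_ofReal (prod_gaussianPDFReal_nonneg v z), smul_eq_mul]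

/-! ### The derivative of the product Gaussian density -/

omit [Fintype ι] [DecidableEq ι] in
/-- `φ_v'(x) = -(x/v) φ_v(x)` for the centred Gaussian density (`v ≠ 0`). [folklore] -/
theorem hasDerivAt_gaussianPDFReal_zero {v : ℝ≥0} (hv : v ≠ 0) (x : ℝ) :
    HasDerivAt (gaussianPDFReal 0 v) (-(x / v) * gaussianPDFReal 0 v x) x := by
  have hv' : (v : ℝ) ≠ 0 := NNReal.coe_ne_zero.mpr hv
  have hdef : gaussianPDFReal 0 v = fun y => (Real.sqrt (2 * Real.pi * v))⁻¹ * Real.exp (-y ^ 2 / (2 * v)) := by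
    funext y; rw [gaussianPDFReal_def]; simp
  rw [hdef]
  have h1 : HasDerivAt (fun y : ℝ => -y ^ 2 / (2 * (v : ℝ))) (-(x / v)) x := by
    have h := (((hasDerivAt_id' x).fun_mul (hasDerivAt_id' x)).fun_neg).div_const (2 * (v : ℝ))
    have e1 : (fun y : ℝ => -y ^ 2 / (2 * (v : ℝ))) = fun y => -(y * y) / (2 * (v : ℝ)) := by
      funext y; ring
    rw [e1]
    refine h.congr_deriv ?_
    rw [one_mul, mul_one, ← two_mul, neg_div, mul_div_mul_left x (v : ℝ) two_ne_zero]
  have h2 := (h1.exp).const_mul ((Real.sqrt (2 * Real.pi * v))⁻¹)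
  refine h2.congr_deriv ?_
  show _ = -(x / (v : ℝ)) * ((Real.sqrt (2 * Real.pi * v))⁻¹ * Real.exp (-x ^ 2 / (2 * v)))
  ring

/-- **`∂_k ∏ᵢ φ_{vᵢ}(zᵢ) = -(z_k/v_k) ∏ᵢ φ_{vᵢ}(zᵢ)`**: the Fréchet derivative of the product
Gaussian density, evaluated on the coordinate vector `e_k`. [folklore] -/
theorem hasFDerivAt_prod_gaussianPDFReal (v : ι → ℝ≥0) (hv : ∀ i, v i ≠ 0) (z : ι → ℝ) :
    ∃ L : (ι → ℝ) →L[ℝ] ℝ, HasFDerivAt (fun z : ι → ℝ => ∏ i, gaussianPDFReal 0 (v i) (z i)) L z ∧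
      ∀ k, L (Pi.single k 1) = -(z k / v k) * ∏ i, gaussianPDFReal 0 (v i) (z i) := by
  have hcomp : ∀ i, HasFDerivAt (fun z : ι → ℝ => gaussianPDFReal 0 (v i) (z i))
      ((-(z i / v i) * gaussianPDFReal 0 (v i) (z i)) • ContinuousLinearMap.proj (R := ℝ) i) z := by
    intro i
    have h := (hasDerivAt_gaussianPDFReal_zero (hv i) (z i)).comp_hasFDerivAt z
      (hasFDerivAt_apply (𝕜 := ℝ) i z)
    exact h
  refine ⟨_, HasFDerivAt.finsetProd (u := Finset.univ) (fun i _ => hcomp i), fun k => ?_⟩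
  rw [FunLike.coe_sum, Finset.sum_apply, Finset.sum_eq_single k]
  · simp only [FunLike.coe_smul, Pi.smul_apply, ContinuousLinearMap.proj_apply, Pi.single_eq_same,
      smul_eq_mul, mul_one]
    rw [← Finset.mul_prod_erase Finset.univ (fun j => gaussianPDFReal 0 (v j) (z j)) (Finset.mem_univ k)]
    ring
  · intro i _ hik
    simp [hik]
  · simp

/-! ### Gaussian integration by parts -/

/-- **Stein's identity / Gaussian integration by parts on `μ_v = ⊗ᵢ N(0,vᵢ)`**: for `H`
differentiable everywhere with `H`, `∂_k H`, `z_k H` integrable,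
`v_k ∫ ∂_k H dμ_v = ∫ z_k H(z) dμ_v`. [folklore] -/
theorem gaussian_integral_byParts (v : ι → ℝ≥0) (hv : ∀ i, v i ≠ 0) {H : (ι → ℝ) → ℝ}
    {H' : (ι → ℝ) → (ι → ℝ) →L[ℝ] ℝ} (hH : ∀ z, HasFDerivAt H (H' z) z) (k : ι)
    (h0 : Integrable H (Measure.pi fun i => gaussianReal 0 (v i)))
    (h1 : Integrable (fun z => H' z (Pi.single k 1)) (Measure.pi fun i => gaussianReal 0 (v i)))
    (h2 : Integrable (fun z => z k * H z) (Measure.pi fun i => gaussianReal 0 (v i))) :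
    (v k : ℝ) * ∫ z, H' z (Pi.single k 1) ∂Measure.pi (fun i => gaussianReal 0 (v i)) =
      ∫ z, z k * H z ∂Measure.pi (fun i => gaussianReal 0 (v i)) := by
  set ρ : (ι → ℝ) → ℝ := fun z => ∏ i, gaussianPDFReal 0 (v i) (z i) with hρ
  choose L hL hLk using hasFDerivAt_prod_gaussianPDFReal v hv
  rw [integral_pi_gaussianReal_eq v hv, integral_pi_gaussianReal_eq v hv]
  rw [integrable_pi_gaussianReal_iff v hv] at h0 h1 h2
  have hvk : (v k : ℝ) ≠ 0 := NNReal.coe_ne_zero.mpr (hv k)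
  -- integration by parts against Lebesgue measure on `ι → ℝ`
  have hibp := integral_bilinear_hasFDerivAt_right_eq_neg_left_of_integrable
    (μ := (volume : Measure (ι → ℝ))) (B := ContinuousLinearMap.mul ℝ ℝ) (f := ρ) (f' := L)
    (g := H) (g' := H') (v := Pi.single k 1) ?_ ?_ ?_ (fun z _ => hL z) (fun z _ => hH z)
  · simp only [ContinuousLinearMap.mul_apply'] at hibp
    rw [hibp]
    have e : (fun z => L z (Pi.single k 1) * H z) = fun z => -(v k : ℝ)⁻¹ * (ρ z * (z k * H z)) := by
      funext z; rw [hLk z k]; simp only [hρ]; field_simp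
    rw [e, integral_const_mul]
    simp only [hρ]
    field_simp
  · simp only [ContinuousLinearMap.mul_apply']
    have e : (fun z => L z (Pi.single k 1) * H z) = fun z => -(v k : ℝ)⁻¹ * (ρ z * (z k * H z)) := by
      funext z; rw [hLk z k]; simp only [hρ]; field_simp
    rw [e]
    exact h2.const_mul _
  · simpa only [ContinuousLinearMap.mul_apply'] using h1
  · simpa only [ContinuousLinearMap.mul_apply'] using h0

/-! ### Skew linear drifts -/

omit [DecidableEq ι] in
/-- Coordinates are in every `L^p` under `μ_v`. [folklore] -/
theorem memLp_eval_pi_gaussianReal (v : ι → ℝ≥0) (p : ℝ≥0∞) (hp : p ≠ ∞) (k : ι) :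
    MemLp (fun z : ι → ℝ => z k) p (Measure.pi fun i => gaussianReal 0 (v i)) := by
  have h : MemLp id p ((Measure.pi fun i => gaussianReal 0 (v i)).map fun z => z k) := by
    rw [(measurePreserving_eval (fun i => gaussianReal 0 (v i)) k).map_eq]
    exact memLp_id_gaussianReal' p hp
  exact h.comp_of_map (measurable_pi_apply k).aemeasurable

omit [DecidableEq ι] in
/-- A continuous bounded function is integrable against `μ_v`. [folklore] -/
theorem integrable_of_continuous_of_bound (v : ι → ℝ≥0) {F : (ι → ℝ) → ℝ} (hF : Continuous F)
    {M : ℝ} (hM : ∀ z, |F z| ≤ M) : Integrable F (Measure.pi fun i => gaussianReal 0 (v i)) :=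
  (integrable_const M).mono' hF.aestronglyMeasurable
    (ae_of_all _ fun z => (Real.norm_eq_abs _).le.trans (hM z))

omit [DecidableEq ι] in
/-- `z_l F(z)` is integrable against `μ_v` for `F` continuous bounded. [folklore] -/
theorem integrable_eval_mul (v : ι → ℝ≥0) {F : (ι → ℝ) → ℝ} (hF : Continuous F)
    {M : ℝ} (hM : ∀ z, |F z| ≤ M) (l : ι) :
    Integrable (fun z : ι → ℝ => z l * F z) (Measure.pi fun i => gaussianReal 0 (v i)) :=
  ((memLp_eval_pi_gaussianReal v 1 (by simp) l).integrable le_rfl).mul_bdd hF.aestronglyMeasurable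
    (ae_of_all _ fun z => (Real.norm_eq_abs _).le.trans (hM z))

omit [DecidableEq ι] in
/-- `z_k z_l F(z)` is integrable against `μ_v` for `F` continuous bounded. [folklore] -/
theorem integrable_eval_mul_eval_mul (v : ι → ℝ≥0) {F : (ι → ℝ) → ℝ} (hF : Continuous F)
    {M : ℝ} (hM : ∀ z, |F z| ≤ M) (k l : ι) :
    Integrable (fun z : ι → ℝ => z k * (z l * F z)) (Measure.pi fun i => gaussianReal 0 (v i)) := by
  have h2 : Integrable (fun z : ι → ℝ => z k * z l) (Measure.pi fun i => gaussianReal 0 (v i)) :=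
    (memLp_eval_pi_gaussianReal v 2 (by simp) k).integrable_mul (memLp_eval_pi_gaussianReal v 2 (by simp) l)
  have h := h2.mul_bdd hF.aestronglyMeasurable (ae_of_all _ fun z => (Real.norm_eq_abs _).le.trans (hM z))
  simpa only [mul_assoc] using h

/-- Expansion of a linear map along the coordinate vectors: `(D z)_k = ∑_l D(e_l)_k z_l`. [folklore] -/
theorem linearMap_apply_eq_sum (D : (ι → ℝ) →ₗ[ℝ] (ι → ℝ)) (z : ι → ℝ) (k : ι) :
    D z k = ∑ l, D (Pi.single l 1) k * z l := by
  conv_lhs => rw [pi_eq_sum_univ' z, map_sum]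
  rw [Finset.sum_apply]
  refine Finset.sum_congr rfl fun l _ => ?_
  rw [map_smul, Pi.smul_apply, smul_eq_mul, mul_comm]

/-- Expansion of a continuous linear functional along the coordinate vectors:
`L w = ∑_k w_k L(e_k)`. [folklore] -/
theorem clm_apply_eq_sum (L : (ι → ℝ) →L[ℝ] ℝ) (w : ι → ℝ) : L w = ∑ k, w k * L (Pi.single k 1) := by
  conv_lhs => rw [pi_eq_sum_univ' w, map_sum]
  refine Finset.sum_congr rfl fun k _ => ?_
  rw [map_smul, smul_eq_mul]

omit [DecidableEq ι] in
/-- A double sum of an antisymmetric kernel against a symmetric one vanishes. [folklore] -/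
theorem sum_sum_mul_eq_zero_of_antisymm {K a : ι → ι → ℝ} (hK : ∀ k l, K k l = -K l k)
    (ha : ∀ k l, a k l = a l k) : ∑ k, ∑ l, K k l * a k l = 0 := by
  have h : ∑ k, ∑ l, K k l * a k l = -∑ k, ∑ l, K k l * a k l := by
    conv_rhs => rw [Finset.sum_comm]
    rw [← Finset.sum_neg_distrib]
    refine Finset.sum_congr rfl fun k _ => ?_
    rw [← Finset.sum_neg_distrib]
    refine Finset.sum_congr rfl fun l _ => ?_
    rw [hK l k, ha l k]
    ring
  linarith

/-- **A Gaussian measure is infinitesimally invariant under a skew linear drift.** Let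
`μ_v = ⊗ᵢ N(0, vᵢ)` on `ι → ℝ` (all `vᵢ ≠ 0`) and let `D` be a linear vector field whose matrix
`B_{kl} = D(e_l)_k` satisfies `v_l B_{kl} = -v_k B_{lk}` (i.e. `B = V K` with `V = diag v` and `K`
antisymmetric — the generator of a one-parameter group of `V`-isometries, which preserve `μ_v`). Then
for every `H ∈ C¹_b`, `∫ DH(z)[D z] dμ_v(z) = 0`. Proof: Gaussian integration by parts turns
`∫ z_l ∂_k H` into `(∫ z_k z_l H - δ_{kl} v_k ∫ H)/v_k`, and `∑_{k,l} K_{kl} ∫ z_k z_l H = 0` by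
antisymmetry. [folklore] -/
theorem integral_fderiv_apply_skewDrift_eq_zero (v : ι → ℝ≥0) (hv : ∀ i, v i ≠ 0)
    (D : (ι → ℝ) →ₗ[ℝ] (ι → ℝ))
    (hD : ∀ k l, (v l : ℝ) * D (Pi.single l 1) k = -((v k : ℝ) * D (Pi.single k 1) l))
    {H : (ι → ℝ) → ℝ} (hH : ContDiff ℝ 1 H) (hb : ∃ M, ∀ z, |H z| ≤ M)
    (hb' : ∃ M', ∀ z, ‖fderiv ℝ H z‖ ≤ M') :
    ∫ z, fderiv ℝ H z (D z) ∂Measure.pi (fun i => gaussianReal 0 (v i)) = 0 := by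
  set μ := Measure.pi fun i => gaussianReal 0 (v i) with hμ
  obtain ⟨M, hM⟩ := hb
  obtain ⟨M', hM'⟩ := hb'
  have hv' : ∀ k, (v k : ℝ) ≠ 0 := fun k => NNReal.coe_ne_zero.mpr (hv k)
  -- the matrix of the drift and the antisymmetric kernel `K = V⁻¹ B`
  set B : ι → ι → ℝ := fun k l => D (Pi.single l 1) k with hB
  set K : ι → ι → ℝ := fun k l => B k l / v k with hK
  have hKanti : ∀ k l, K k l = -K l k := by
    intro k l
    have h := hD k l
    simp only [hK, hB]
    rw [eq_neg_iff_add_eq_zero, div_add_div _ _ (hv' k) (hv' l), div_eq_zero_iff]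
    left
    linarith
  have hKdiag : ∀ k, K k k = 0 := fun k => by linarith [hKanti k k]
  have hBK : ∀ k l, B k l = (v k : ℝ) * K k l := fun k l => by
    simp only [hK]; rw [← mul_div_assoc, mul_div_cancel_left₀ _ (hv' k)]
  -- the partial derivatives of `H`
  set dH : ι → (ι → ℝ) → ℝ := fun k z => fderiv ℝ H z (Pi.single k 1) with hdH
  have hHc : Continuous H := hH.continuous
  have hdHc : ∀ k, Continuous (dH k) := fun k =>
    (ContinuousLinearMap.apply ℝ ℝ (Pi.single k 1)).continuous.comp (hH.continuous_fderiv one_ne_zero)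
  have hdHb : ∀ k z, |dH k z| ≤ M' := by
    intro k z
    rw [← Real.norm_eq_abs]
    calc ‖fderiv ℝ H z (Pi.single k 1)‖ ≤ ‖fderiv ℝ H z‖ * ‖(Pi.single k 1 : ι → ℝ)‖ :=
          ContinuousLinearMap.le_opNorm _ _
      _ ≤ M' * 1 := by
          refine mul_le_mul (hM' z) ?_ (norm_nonneg _) ((norm_nonneg _).trans (hM' z))
          rw [Pi.norm_single, norm_one]
      _ = M' := mul_one _
  -- Step 1: expand the integrand, `DH(z)[Dz] = ∑_k ∑_l B_kl z_l ∂_k H(z)`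
  have hexp : ∀ z, fderiv ℝ H z (D z) = ∑ k, ∑ l, B k l * (z l * dH k z) := by
    intro z
    rw [clm_apply_eq_sum]
    refine Finset.sum_congr rfl fun k _ => ?_
    rw [linearMap_apply_eq_sum, Finset.sum_mul]
    refine Finset.sum_congr rfl fun l _ => ?_
    simp only [hB, hdH]
    ring
  -- Step 2: Stein, `v_k ∫ z_l ∂_k H = ∫ z_k z_l H - [l = k] v_k ∫ H`
  have hstein : ∀ k l, (v k : ℝ) * ∫ z, z l * dH k z ∂μ =
      (∫ z, z k * (z l * H z) ∂μ) - if l = k then (v k : ℝ) * ∫ z, H z ∂μ else 0 := by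
    intro k l
    have hH2 : ∀ z, HasFDerivAt (fun z : ι → ℝ => z l * H z)
        (z l • fderiv ℝ H z + H z • ContinuousLinearMap.proj (R := ℝ) l) z := by
      intro z
      exact (hasFDerivAt_apply (𝕜 := ℝ) l z).fun_mul ((hH.differentiable one_ne_zero) z).hasFDerivAt
    have hev : ∀ z, ((z l • fderiv ℝ H z + H z • ContinuousLinearMap.proj (R := ℝ) l :
        (ι → ℝ) →L[ℝ] ℝ) (Pi.single k 1)) = z l * dH k z + (if l = k then H z else 0) := by
      intro z
      simp [hdH, Pi.single_apply]
    have hi0 : Integrable (fun z : ι → ℝ => z l * H z) μ := integrable_eval_mul v hHc hM l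
    have hi1 : Integrable (fun z => ((z l • fderiv ℝ H z + H z • ContinuousLinearMap.proj (R := ℝ) l :
        (ι → ℝ) →L[ℝ] ℝ) (Pi.single k 1))) μ := by
      simp_rw [hev]
      refine (integrable_eval_mul v (hdHc k) (hdHb k) l).add ?_
      split_ifs
      · exact integrable_of_continuous_of_bound v hHc hM
      · exact integrable_zero _ _ _
    have hi2 : Integrable (fun z : ι → ℝ => z k * (z l * H z)) μ := integrable_eval_mul_eval_mul v hHc hM k l
    have key := gaussian_integral_byParts v hv hH2 k hi0 hi1 hi2
    simp_rw [hev] at key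
    rw [integral_add (integrable_eval_mul v (hdHc k) (hdHb k) l)] at key
    · rw [← key]
      split_ifs
      · rw [mul_add]; ring
      · simp [hμ]
    · split_ifs
      · exact integrable_of_continuous_of_bound v hHc hM
      · exact integrable_zero _ _ _
  -- Step 3: sum up
  have hint : ∀ k l, Integrable (fun z : ι → ℝ => B k l * (z l * dH k z)) μ := fun k l =>
    (integrable_eval_mul v (hdHc k) (hdHb k) l).const_mul _
  simp_rw [hexp]
  rw [integral_finsetSum _ fun k _ => integrable_finsetSum _ fun l _ => hint k l]
  simp_rw [integral_finsetSum _ fun l _ => hint _ l, integral_const_mul]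
  -- replace `B_kl ∫ z_l ∂_k H` by `K_kl (∫ z_k z_l H - [l=k] v_k ∫ H)`
  have hterm : ∀ k l, B k l * ∫ z, z l * dH k z ∂μ =
      K k l * ∫ z, z k * (z l * H z) ∂μ - K k l * (if l = k then (v k : ℝ) * ∫ z, H z ∂μ else 0) := by
    intro k l
    rw [hBK, mul_comm (v k : ℝ) (K k l), mul_assoc, hstein, mul_sub]
  simp_rw [hterm, Finset.sum_sub_distrib]
  rw [sum_sum_mul_eq_zero_of_antisymm hKanti]
  · simp [hKdiag]
  · intro k l
    refine integral_congr_ae (ae_of_all _ fun z => ?_)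
    dsimp only
    ring

end Summit.AtomisticToContinuum.FouriersLaw.Theorems.ParityLiouvilleSeed.HarmonicWitness

end
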